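import Literature.Analysis.SegalBargmann.FockHermiteComplete
import HarnessLib

/-!
# C4 INNER, brick S (part 1a): Gaussian moments with a linear term and the kernel-weighted Gaussian functional on polynomial symbols
# (lane A of S-BASE, crux `TwistedTraceScaling` stmt-QuantumFields-20203; sub-target C4, design note `pub/ym-fleet/ym-luscher-20007-p1/COARSE-DESIGN.md` §21.5 S)

Analytic half of the Mehler eigenfunction theorem (`…MehlerHermite`, next file), in the style of `Literature.Analysis.SegalBargmann.FockHermiteL2` (`gint`, `gint_div`)
but with general widths `s_k > 0` and linear terms `κ_k` (the Mehler kernel times the Hermite weight `e^{−π|y|²}` is such a shifted Gaussian):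
* §1 one-dimensional moments `t^m e^{−s t² + κ t}`: integrability (`integrable_kmon`), derivative, the integration-by-parts identity
  `m·J_{m−1} + κ·J_m = 2s·J_{m+1}` (`integral_kmon_div`), and `J_0 = √(π/s)·e^{κ²/(4s)}` (`integral_kmon_zero`);
* §2 the functional `gintK s κ r = ∫ r(y) Π_k e^{−s_k y_k² + κ_k y_k} dy` on `r : MvPolynomial σ ℂ` (Fubini): `gintK_monomial`, `gintK_one`,
  ★ `gintK_div : gintK (∂_j r) = 2 s_j · gintK (X_j r) − κ_j · gintK r`.
HONEST FRAMING: classical Gaussian calculus for a stub of a child of the CONDITIONAL reduction route (femto rung R2b1); not infinite volume, not a gap, not Clay.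

## References
* G. B. Folland, *Harmonic Analysis in Phase Space*, Princeton UP 1989, §1.7 (integration by parts behind (iv), (vii)). [Folland1989]
-/

set_option autoImplicit false

open MvPolynomial Complex MeasureTheory
open scoped Real

namespace Summit.QuantumFields.YangMills.Theorems.FemtoTransferGap.Mehler

open Literature.Analysis.SegalBargmann

noncomputable section

/-! ### §1 One-dimensional Gaussian moments with a linear term: `t^m e^{−s t² + κ t}` -/

/-- The 1-D moment functions `t ↦ t^m e^{−s t² + κ t}` (complex-valued). [folklore] -/
def kmon (s κ : ℝ) (m : ℕ) (t : ℝ) : ℂ := (t : ℂ) ^ m * cexp (-(s : ℂ) * (t : ℂ) ^ 2 + (κ : ℂ) * (t : ℂ))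

/-- `kmon` is the complexification of the real moment function. [folklore] -/
theorem kmon_eq_ofReal (s κ : ℝ) (m : ℕ) (t : ℝ) : kmon s κ m t = ((t ^ m * Real.exp (-s * t ^ 2 + κ * t) : ℝ) : ℂ) := by
  simp only [kmon]
  push_cast
  rfl

/-- The linear term is dominated by half the quadratic one: `e^{−s t² + κt} ≤ e^{κ²/(2s)} · e^{−(s/2) t²}`. [folklore] -/
theorem exp_quadratic_linear_le {s : ℝ} (hs : 0 < s) (κ t : ℝ) :
    Real.exp (-s * t ^ 2 + κ * t) ≤ Real.exp (κ ^ 2 / (2 * s)) * Real.exp (-(s / 2) * t ^ 2) := by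
  rw [← Real.exp_add]
  refine Real.exp_le_exp.2 ?_
  have h : 0 ≤ (s / 2) * (t - κ / s) ^ 2 := by positivity
  have e : (s / 2) * (t - κ / s) ^ 2 = (s / 2) * t ^ 2 - κ * t + κ ^ 2 / (2 * s) := by
    field_simp
    ring
  linarith [h, e]

/-- Each moment `t ↦ t^m e^{−s t² + κt}` (`s > 0`) is Lebesgue integrable. [folklore] -/
theorem integrable_kmon {s : ℝ} (hs : 0 < s) (κ : ℝ) (m : ℕ) : Integrable (kmon s κ m) := by
  have hg := (integrable_rpow_mul_exp_neg_mul_sq (b := s / 2) (by positivity) (s := (m : ℝ))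
    (by have : (0 : ℝ) ≤ m := Nat.cast_nonneg m; linarith))
  have hdom : Integrable (fun t : ℝ => Real.exp (κ ^ 2 / (2 * s)) * |t ^ (m : ℝ) * Real.exp (-(s / 2) * t ^ 2)|) :=
    hg.abs.const_mul _
  refine hdom.mono' ?_ (ae_of_all _ fun t => ?_)
  · exact (Continuous.mul (by fun_prop) (by fun_prop)).aestronglyMeasurable
  · rw [kmon_eq_ofReal, Complex.norm_real, Real.norm_eq_abs, abs_mul, abs_of_pos (Real.exp_pos _), Real.rpow_natCast, abs_mul,
      abs_of_pos (Real.exp_pos _)]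
    have := exp_quadratic_linear_le hs κ t
    have h0 : 0 ≤ |t ^ m| := abs_nonneg _
    nlinarith

/-- `(e^{−s u² + κu})' = (−2su + κ) e^{−s u² + κ u}` at `u = t`. [folklore] -/
theorem hasDerivAt_cexp_quadLin (s κ t : ℝ) :
    HasDerivAt (fun u : ℝ => cexp (-(s : ℂ) * (u : ℂ) ^ 2 + (κ : ℂ) * (u : ℂ)))
      ((-(2 * s : ℂ) * (t : ℂ) + (κ : ℂ)) * cexp (-(s : ℂ) * (t : ℂ) ^ 2 + (κ : ℂ) * (t : ℂ))) t := by
  have h1 : HasDerivAt (fun u : ℂ => -(s : ℂ) * u ^ 2 + (κ : ℂ) * u) (-(s : ℂ) * (2 * (t : ℂ)) + (κ : ℂ)) (t : ℂ) := by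
    have ha := (hasDerivAt_pow 2 (t : ℂ)).const_mul (-(s : ℂ))
    have hb := (hasDerivAt_id (t : ℂ)).const_mul (κ : ℂ)
    have := ha.add hb
    refine (this.congr_deriv (by simp)).congr_of_eventuallyEq (Filter.Eventually.of_forall fun u => ?_)
    simp
  have h2 := (h1.cexp).comp_ofReal
  refine h2.congr_deriv ?_
  ring

/-- `(t^{m+1} e^{−st²+κt})' = (m+1) t^m e^{…} − 2s t^{m+2} e^{…} + κ t^{m+1} e^{…}`. [folklore] -/
theorem hasDerivAt_kmon_succ (s κ : ℝ) (m : ℕ) (t : ℝ) :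
    HasDerivAt (kmon s κ (m + 1)) (((m : ℂ) + 1) * kmon s κ m t - (2 * s : ℂ) * kmon s κ (m + 2) t + (κ : ℂ) * kmon s κ (m + 1) t) t := by
  have h1 : HasDerivAt (fun u : ℝ => (u : ℂ) ^ (m + 1)) (((m : ℂ) + 1) * (t : ℂ) ^ m) t := by
    have := (hasDerivAt_pow (m + 1) (t : ℂ)).comp_ofReal
    refine this.congr_deriv ?_
    push_cast
    ring
  have h := h1.mul (hasDerivAt_cexp_quadLin s κ t)
  refine h.congr_deriv ?_
  simp only [kmon]
  ring

/-- `(e^{−st²+κt})' = −2s t e^{…} + κ e^{…}`. [folklore] -/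
theorem hasDerivAt_kmon_zero (s κ t : ℝ) :
    HasDerivAt (kmon s κ 0) (-(2 * s : ℂ) * kmon s κ 1 t + (κ : ℂ) * kmon s κ 0 t) t := by
  have h := hasDerivAt_cexp_quadLin s κ t
  have hfun : kmon s κ 0 = fun u : ℝ => cexp (-(s : ℂ) * (u : ℂ) ^ 2 + (κ : ℂ) * (u : ℂ)) := by
    funext u; simp [kmon]
  rw [hfun]
  refine h.congr_deriv ?_
  simp only [kmon, pow_one]
  ring

/-- Integration by parts: `(m+1) J_m − 2s J_{m+2} + κ J_{m+1} = 0`. [folklore] -/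
theorem integral_kmon_succ_succ {s : ℝ} (hs : 0 < s) (κ : ℝ) (m : ℕ) :
    ((m : ℂ) + 1) * (∫ t, kmon s κ m t) - (2 * s : ℂ) * (∫ t, kmon s κ (m + 2) t) + (κ : ℂ) * ∫ t, kmon s κ (m + 1) t = 0 := by
  have hi := integrable_kmon hs κ
  have hint : Integrable (fun t => ((m : ℂ) + 1) * kmon s κ m t - (2 * s : ℂ) * kmon s κ (m + 2) t + (κ : ℂ) * kmon s κ (m + 1) t) :=
    (((hi m).const_mul _).sub ((hi (m + 2)).const_mul _)).add ((hi (m + 1)).const_mul _)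
  have hAB : Integrable (fun t => ((m : ℂ) + 1) * kmon s κ m t - (2 * s : ℂ) * kmon s κ (m + 2) t) :=
    ((hi m).const_mul _).sub ((hi (m + 2)).const_mul _)
  have h := integral_eq_zero_of_hasDerivAt_of_integrable (hasDerivAt_kmon_succ s κ m) hint (hi (m + 1))
  rw [integral_add hAB ((hi (m + 1)).const_mul _), integral_sub ((hi m).const_mul _) ((hi (m + 2)).const_mul _), integral_const_mul,
    integral_const_mul, integral_const_mul] at h
  exact h

/-- … and at `m = 0`: `−2s J_1 + κ J_0 = 0`. [folklore] -/
theorem integral_kmon_one {s : ℝ} (hs : 0 < s) (κ : ℝ) :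
    -(2 * s : ℂ) * (∫ t, kmon s κ 1 t) + (κ : ℂ) * ∫ t, kmon s κ 0 t = 0 := by
  have hi := integrable_kmon hs κ
  have hint : Integrable (fun t => -(2 * s : ℂ) * kmon s κ 1 t + (κ : ℂ) * kmon s κ 0 t) :=
    ((hi 1).const_mul _).add ((hi 0).const_mul _)
  have h := integral_eq_zero_of_hasDerivAt_of_integrable (hasDerivAt_kmon_zero s κ) hint (hi 0)
  rw [integral_add ((hi 1).const_mul _) ((hi 0).const_mul _), integral_const_mul, integral_const_mul] at h
  exact h

/-- The "divergence" of a moment: `m·J_{m−1} − 2s·J_{m+1} + κ·J_m = 0`, uniformly in `m ≥ 0`. [folklore] -/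
theorem integral_kmon_div {s : ℝ} (hs : 0 < s) (κ : ℝ) (m : ℕ) :
    (m : ℂ) * (∫ t, kmon s κ (m - 1) t) - (2 * s : ℂ) * (∫ t, kmon s κ (m + 1) t) + (κ : ℂ) * ∫ t, kmon s κ m t = 0 := by
  cases m with
  | zero => simpa using integral_kmon_one hs κ
  | succ n =>
      rw [Nat.succ_sub_one]
      push_cast
      exact integral_kmon_succ_succ hs κ n

/-- The Gaussian integral with a linear term: `∫ e^{−s t² + κ t} dt = √(π/s) · e^{κ²/(4s)}`. [folklore] -/
theorem integral_kmon_zero {s : ℝ} (hs : 0 < s) (κ : ℝ) :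
    ∫ t, kmon s κ 0 t = ((Real.sqrt (π / s) * Real.exp (κ ^ 2 / (4 * s)) : ℝ) : ℂ) := by
  have hfun : kmon s κ 0 = fun t : ℝ => ((Real.exp (-s * t ^ 2 + κ * t) : ℝ) : ℂ) := by
    funext t; rw [kmon_eq_ofReal, pow_zero, one_mul]
  rw [hfun]
  change ∫ t : ℝ, ((Real.exp (-s * t ^ 2 + κ * t) : ℝ) : ℂ) = _
  rw [integral_complex_ofReal]
  congr 1
  have hshift : (fun t : ℝ => Real.exp (-s * t ^ 2 + κ * t)) = fun t : ℝ => Real.exp (κ ^ 2 / (4 * s)) * Real.exp (-s * (t - κ / (2 * s)) ^ 2) := by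
    funext t
    rw [← Real.exp_add]
    congr 1
    field_simp
    ring
  rw [hshift, integral_const_mul]
  have htr : ∫ t : ℝ, Real.exp (-s * (t - κ / (2 * s)) ^ 2) = ∫ t : ℝ, Real.exp (-s * t ^ 2) :=
    integral_sub_right_eq_self (fun t => Real.exp (-s * t ^ 2)) (κ / (2 * s))
  rw [htr, integral_gaussian, mul_comm]

/-! ### §2 The kernel-weighted Gaussian functional on symbols -/

section NDim

variable {σ : Type*} [Fintype σ] [DecidableEq σ]

/-- The weight `Π_k e^{−s_k y_k² + κ_k y_k}`. [folklore] -/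
def kweight (s κ : σ → ℝ) (y : σ → ℝ) : ℂ := ∏ k, cexp (-(s k : ℂ) * (y k : ℂ) ^ 2 + (κ k : ℂ) * (y k : ℂ))

omit [DecidableEq σ] in
/-- `y^β · Π_k e^{−s_k y_k² + κ_k y_k} = Π_k (y_k^{β_k} e^{−s_k y_k² + κ_k y_k})`. [folklore] -/
theorem eval_monomial_mul_kweight (s κ : σ → ℝ) (β : σ →₀ ℕ) (y : σ → ℝ) :
    eval (fun k => (y k : ℂ)) (monomial β (1 : ℂ)) * kweight s κ y = ∏ k, kmon (s k) (κ k) (β k) (y k) := by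
  rw [eval_monomial, one_mul, Finsupp.prod_fintype _ _ (fun i => pow_zero _), kweight, ← Finset.prod_mul_distrib]
  rfl

omit [DecidableEq σ] in
/-- Every monomial times the weight is integrable on `ℝ^σ`. [folklore] -/
theorem integrable_monomial_kweight {s : σ → ℝ} (hs : ∀ k, 0 < s k) (κ : σ → ℝ) (β : σ →₀ ℕ) :
    Integrable (fun y : σ → ℝ => eval (fun k => (y k : ℂ)) (monomial β (1 : ℂ)) * kweight s κ y) := by
  have hfun : (fun y : σ → ℝ => eval (fun k => (y k : ℂ)) (monomial β (1 : ℂ)) * kweight s κ y) =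
      fun y : σ → ℝ => ∏ k, kmon (s k) (κ k) (β k) (y k) := by
    funext y; exact eval_monomial_mul_kweight s κ β y
  rw [hfun]
  exact Integrable.fintype_prod (fun k => integrable_kmon (hs k) (κ k) (β k))

omit [DecidableEq σ] in
/-- Every `p(y) · weight` is integrable. [folklore] -/
theorem integrable_eval_kweight {s : σ → ℝ} (hs : ∀ k, 0 < s k) (κ : σ → ℝ) (p : MvPolynomial σ ℂ) :
    Integrable (fun y : σ → ℝ => eval (fun k => (y k : ℂ)) p * kweight s κ y) := by
  induction p using MvPolynomial.induction_on' with
  | monomial β a =>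
      have hfun : (fun y : σ → ℝ => eval (fun k => (y k : ℂ)) (monomial β a) * kweight s κ y) =
          fun y : σ → ℝ => a * (eval (fun k => (y k : ℂ)) (monomial β (1 : ℂ)) * kweight s κ y) := by
        funext y
        rw [monomial_eq_smul β a, smul_eval, mul_assoc]
      rw [hfun]
      exact (integrable_monomial_kweight hs κ β).const_mul a
  | add p q hp hq =>
      have hfun : (fun y : σ → ℝ => eval (fun k => (y k : ℂ)) (p + q) * kweight s κ y) =
          fun y : σ → ℝ => eval (fun k => (y k : ℂ)) p * kweight s κ y + eval (fun k => (y k : ℂ)) q * kweight s κ y := by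
        funext y; rw [map_add, add_mul]
      rw [hfun]
      exact hp.add hq

/-- The kernel-weighted Gaussian functional on symbols: `gintK s κ r = ∫ r(y) Π_k e^{−s_k y_k² + κ_k y_k} dy` (`s_k > 0`). [folklore] -/
def gintK {s : σ → ℝ} (hs : ∀ k, 0 < s k) (κ : σ → ℝ) : MvPolynomial σ ℂ →ₗ[ℂ] ℂ where
  toFun r := ∫ y : σ → ℝ, eval (fun k => (y k : ℂ)) r * kweight s κ y
  map_add' p q := by
    simp only [map_add, add_mul]
    exact integral_add (integrable_eval_kweight hs κ p) (integrable_eval_kweight hs κ q)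
  map_smul' c p := by
    simp only [smul_eval, smul_eq_mul, mul_assoc, RingHom.id_apply]
    exact integral_const_mul c _

omit [DecidableEq σ] in
/-- Unfolding. [folklore] -/
theorem gintK_apply {s : σ → ℝ} (hs : ∀ k, 0 < s k) (κ : σ → ℝ) (r : MvPolynomial σ ℂ) :
    gintK hs κ r = ∫ y : σ → ℝ, eval (fun k => (y k : ℂ)) r * kweight s κ y := rfl

omit [DecidableEq σ] in
/-- Fubini: `gintK (y^β) = Π_k ∫ t^{β_k} e^{−s_k t² + κ_k t} dt`. [folklore] -/
theorem gintK_monomial {s : σ → ℝ} (hs : ∀ k, 0 < s k) (κ : σ → ℝ) (β : σ →₀ ℕ) :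
    gintK hs κ (monomial β (1 : ℂ)) = ∏ k, ∫ t, kmon (s k) (κ k) (β k) t := by
  rw [gintK_apply]
  simp_rw [eval_monomial_mul_kweight]
  exact integral_fintype_prod_volume_eq_prod (fun k => kmon (s k) (κ k) (β k))

omit [DecidableEq σ] in
/-- `gintK 1 = Π_k √(π/s_k) e^{κ_k²/(4 s_k)}`. [folklore] -/
theorem gintK_one {s : σ → ℝ} (hs : ∀ k, 0 < s k) (κ : σ → ℝ) :
    gintK hs κ (1 : MvPolynomial σ ℂ) = ∏ k, (((Real.sqrt (π / s k) * Real.exp (κ k ^ 2 / (4 * s k)) : ℝ)) : ℂ) := by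
  rw [show (1 : MvPolynomial σ ℂ) = monomial (0 : σ →₀ ℕ) (1 : ℂ) from rfl, gintK_monomial]
  exact Finset.prod_congr rfl fun k _ => by rw [Finsupp.coe_zero, Pi.zero_apply, integral_kmon_zero (hs k)]

/-- ★ **Integration by parts in `ℝ^σ`**, monomial case: `gintK(∂_j y^β) − 2 s_j gintK(y_j y^β) + κ_j gintK(y^β) = 0`. [folklore] -/
theorem gintK_div_monomial {s : σ → ℝ} (hs : ∀ k, 0 < s k) (κ : σ → ℝ) (j : σ) (β : σ →₀ ℕ) :
    gintK hs κ (pderiv j (monomial β (1 : ℂ))) - (2 * s j : ℂ) * gintK hs κ (X j * monomial β 1) + (κ j : ℂ) * gintK hs κ (monomial β 1) = 0 := by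
  rw [pderiv_monomial, one_mul, X_mul_monomial_one, monomial_eq_smul (β - Finsupp.single j 1), map_smul, gintK_monomial,
    gintK_monomial, gintK_monomial]
  have e1 : ∏ k, (∫ t, kmon (s k) (κ k) ((β - Finsupp.single j 1 : σ →₀ ℕ) k) t) =
      (∫ t, kmon (s j) (κ j) ((β - Finsupp.single j 1 : σ →₀ ℕ) j) t) *
        ∏ k ∈ Finset.univ.erase j, ∫ t, kmon (s k) (κ k) ((β - Finsupp.single j 1 : σ →₀ ℕ) k) t :=
    (Finset.mul_prod_erase _ _ (Finset.mem_univ j)).symm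
  have e2 : ∏ k, (∫ t, kmon (s k) (κ k) ((β + Finsupp.single j 1 : σ →₀ ℕ) k) t) =
      (∫ t, kmon (s j) (κ j) ((β + Finsupp.single j 1 : σ →₀ ℕ) j) t) *
        ∏ k ∈ Finset.univ.erase j, ∫ t, kmon (s k) (κ k) ((β + Finsupp.single j 1 : σ →₀ ℕ) k) t :=
    (Finset.mul_prod_erase _ _ (Finset.mem_univ j)).symm
  have e3 : ∏ k, (∫ t, kmon (s k) (κ k) (β k) t) = (∫ t, kmon (s j) (κ j) (β j) t) * ∏ k ∈ Finset.univ.erase j, ∫ t, kmon (s k) (κ k) (β k) t :=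
    (Finset.mul_prod_erase _ _ (Finset.mem_univ j)).symm
  rw [e1, e2, e3]
  have h1 : ∏ k ∈ Finset.univ.erase j, (∫ t, kmon (s k) (κ k) ((β - Finsupp.single j 1 : σ →₀ ℕ) k) t) =
      ∏ k ∈ Finset.univ.erase j, ∫ t, kmon (s k) (κ k) (β k) t :=
    Finset.prod_congr rfl fun k hk => by
      rw [Finsupp.tsub_apply, Finsupp.single_apply, if_neg (Finset.ne_of_mem_erase hk).symm, tsub_zero]
  have h2 : ∏ k ∈ Finset.univ.erase j, (∫ t, kmon (s k) (κ k) ((β + Finsupp.single j 1 : σ →₀ ℕ) k) t) =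
      ∏ k ∈ Finset.univ.erase j, ∫ t, kmon (s k) (κ k) (β k) t :=
    Finset.prod_congr rfl fun k hk => by
      rw [Finsupp.add_apply, Finsupp.single_apply, if_neg (Finset.ne_of_mem_erase hk).symm, add_zero]
  rw [h1, h2, Finsupp.tsub_apply, Finsupp.add_apply, Finsupp.single_eq_same, smul_eq_mul]
  have h := integral_kmon_div (hs j) (κ j) (β j)
  linear_combination (∏ k ∈ Finset.univ.erase j, ∫ t, kmon (s k) (κ k) (β k) t) * h

/-- ★ **Integration by parts in `ℝ^σ`**: `gintK(∂_j r) = 2 s_j · gintK(X_j r) − κ_j · gintK(r)` for every polynomial `r`. [folklore] -/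
theorem gintK_div {s : σ → ℝ} (hs : ∀ k, 0 < s k) (κ : σ → ℝ) (j : σ) (r : MvPolynomial σ ℂ) :
    gintK hs κ (pderiv j r) = (2 * s j : ℂ) * gintK hs κ (X j * r) - (κ j : ℂ) * gintK hs κ r := by
  suffices h : gintK hs κ (pderiv j r) - (2 * s j : ℂ) * gintK hs κ (X j * r) + (κ j : ℂ) * gintK hs κ r = 0 by
    linear_combination h
  induction r using MvPolynomial.induction_on' with
  | monomial β a =>
      rw [monomial_eq_smul β a, Derivation.map_smul, mul_smul_comm, map_smul, map_smul, map_smul, smul_eq_mul, smul_eq_mul, smul_eq_mul]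
      have h := gintK_div_monomial hs κ j β
      linear_combination a * h
  | add p q hp hq =>
      rw [map_add, mul_add, map_add, map_add, map_add]
      linear_combination hp + hq

end NDim

end

end Summit.QuantumFields.YangMills.Theorems.FemtoTransferGap.Mehler
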